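import Literature.AnabelianGeometry.AbsoluteAnabelian.ProfiniteOuterSemidirectProduct
import HarnessLib

/-!
# `G ⋊^out J` (profinite): conjugation on `G` is by the `Aut`-component ([SemiAnbd] §0 p. 5; [AbsTopII] Def 1.2 (ii))

Mochizuki, *Semi-graphs of anabelioids*, Publ. RIMS **42** (2006), §0 p. 5 [cite: MochizukiSemiAnbd2006, §0 p.5];
[AbsTopII] Def 1.2 (ii) p. 10 (`Π_H := Π_𝔾 ⋊^out H` acts on `Π_𝔾` through `ρ_H : H → Aut(𝔾) ⊆ Out(Π_𝔾)`).

Companion of `ProfiniteOuterSemidirectProduct.lean` (abc-iut cell, GAP row «G-P13-GR» = G-w5d226-2, last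
clause «every element's conjugation on the image of G is (a representative of) ρ of its H-component»):
for `h ∈ G ⋊^out J` the bi-continuous automorphism `conjAutOf h := profiniteAutEquiv⁻¹ (h.1)` of `G`
satisfies `inl (conjAutOf h x) = h · inl x · h⁻¹` (`inlProfinite_conjAutOf`) and represents the outer
class `θ (h.2)` (`outProj_conjAutOf`, `mk_conjAutOf`) — the shape of the hypothesis `hgr` of
abc-iut-w5-d226's `DPSCData.graphic_vertSub_of_psc`.  Nothing here bears on [IUTchIII] Cor. 3.12.
-/

namespace Literature.AnabelianGeometry.AbsoluteAnabelian

open Literature.AnabelianGeometry.EtaleTheta Literature.AnabelianGeometry.SemiGraphs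
open Topology

universe u

variable {G : Type u} [Group G] [TopologicalSpace G] [IsTopologicalGroup G] [CompactSpace G]
  [TotallyDisconnectedSpace G] (hG : IsTopologicallyFinitelyGenerated G)
  {J : Type u} [Group J] [TopologicalSpace J] [IsTopologicalGroup J] [CompactSpace J]
  [TotallyDisconnectedSpace J] (θ : J →ₜ* outProfinite hG)

/-- The `Aut`-component of `h ∈ G ⋊^out J` as a bi-continuous automorphism of `G`
(`profiniteAutEquiv⁻¹` of the first coordinate). [cite: MochizukiSemiAnbd2006, §0 p.5] -/
noncomputable def autComponent (h : outerSemidirectProfinite hG θ) : contMulAut G :=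
  (profiniteAutEquiv (hG := hG)).symm h.1.1

/-- `profiniteAutEquiv (autComponent h) = h.1.1`. [cite: MochizukiSemiAnbd2006, §0 p.5] -/
@[simp] theorem profiniteAutEquiv_autComponent (h : outerSemidirectProfinite hG θ) :
    profiniteAutEquiv (hG := hG) (autComponent hG θ h) = h.1.1 :=
  (profiniteAutEquiv (hG := hG)).apply_symm_apply _

/-- The `Aut`-component as a bi-continuous multiplicative equivalence `G ≃ₜ* G`.
[cite: MochizukiSemiAnbd2006, §0 p.5] -/
noncomputable def conjAutOf (h : outerSemidirectProfinite hG θ) : G ≃ₜ* G where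
  toMulEquiv := ((autComponent hG θ h).1 : MulAut G)
  continuous_toFun := (autComponent hG θ h).2.1
  continuous_invFun := (autComponent hG θ h).2.2

/-- `conjAutOf h` is the `Aut`-component applied. [cite: MochizukiSemiAnbd2006, §0 p.5] -/
@[simp] theorem conjAutOf_apply (h : outerSemidirectProfinite hG θ) (x : G) :
    conjAutOf hG θ h x = ((autComponent hG θ h).1 : MulAut G) x := rfl

/-- **The `Aut`-component of `h` represents the outer class `θ (h.2)`** (algebraic `TopOut G` form).
[cite: MochizukiSemiAnbd2006, §0 p.5] -/
theorem mk_autComponent (h : outerSemidirectProfinite hG θ) :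
    TopOut.mk G (autComponent hG θ h) = outerActionOfContinuous hG θ h.1.2 :=
  (outerSemidirectProfiniteEquiv hG θ h).2

/-- The same in the profinite `Out(G)`: `outProj h.1 = θ h.2`. [cite: MochizukiSemiAnbd2006, §0 p.5] -/
theorem outProj_autComponent (h : outerSemidirectProfinite hG θ) :
    outProj hG (profiniteAutEquiv (hG := hG) (autComponent hG θ h)) = θ h.1.2 := by
  rw [profiniteAutEquiv_autComponent]
  exact h.2

/-- **Conjugation by `h ∈ G ⋊^out J` on the image of `G` is the `Aut`-component of `h`**:
`h · inl x · h⁻¹ = inl (conjAutOf h x)`. [cite: MochizukiSemiAnbd2006, §0 p.5] -/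
theorem inlProfinite_conjAutOf (h : outerSemidirectProfinite hG θ) (x : G) :
    inlProfinite hG θ (conjAutOf hG θ h x) = h * inlProfinite hG θ x * h⁻¹ := by
  apply Subtype.ext
  refine Prod.ext ?_ ?_
  · -- `Aut`-components, in `profiniteAut hG`: transport `conj (φ x) = φ ∘ conj x ∘ φ⁻¹` along `toProfiniteAut`
    change conjProfiniteAut hG (((autComponent hG θ h).1 : MulAut G) x) =
      h.1.1 * conjProfiniteAut hG x * (h.1.1)⁻¹
    have hh : h.1.1 = toProfiniteAut hG (autComponent hG θ h) :=
      (profiniteAutEquiv_autComponent hG θ h).symm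
    rw [hh, conjProfiniteAut_apply, conjProfiniteAut_apply, ← map_mul, ← map_inv, ← map_mul]
    congr 1
    apply Subtype.ext
    ext y
    change ((autComponent hG θ h).1 : MulAut G) x * y * (((autComponent hG θ h).1 : MulAut G) x)⁻¹ =
      ((autComponent hG θ h).1 : MulAut G)
        (x * ((autComponent hG θ h).1 : MulAut G).symm y * x⁻¹)
    rw [map_mul, map_mul, map_inv, MulEquiv.apply_symm_apply]
  · -- `J`-components: `1 = j · 1 · j⁻¹`
    change (1 : J) = h.1.2 * 1 * (h.1.2)⁻¹
    rw [mul_one, mul_inv_cancel]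

/-- The hypothesis shape `hgr` of abc-iut-w5-d226's `DPSCData.graphic_vertSub_of_psc`, first conjunct:
every `h ∈ G ⋊^out J` conjugates the image of `G` by a bi-continuous automorphism of `G` compatible with
`inl`. [cite: MochizukiAbsTopII2013, Def 1.2 (ii) p.10] -/
theorem outerSemidirectProfinite_exists_continuousMulEquiv_conj (h : outerSemidirectProfinite hG θ) :
    ∃ α : G ≃ₜ* G, ∀ x : G, inlProfinite hG θ (α x) = h * inlProfinite hG θ x * h⁻¹ :=
  ⟨conjAutOf hG θ h, inlProfinite_conjAutOf hG θ h⟩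

end Literature.AnabelianGeometry.AbsoluteAnabelian
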